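import Mathlib
import Summits.SmoothPoincare4.SmoothPoincare4.Theorems.SoloInformedFusionOneDiscGroup

/-!
# Hom-counting separates the `6₁` disc group from the group of the 2-twist-spun trefoil

Solo residency `solo-SmoothPoincare4-informed`, session 6 — kernel certificate for the group-theoretic
core of the "π₁ filter" (prose claim C35(i) of the residency):

*Fox's 2-knot* `S = A ∪ ρ(A)‾ ⊂ S⁴`, the union of the two ribbon discs of the stevedore knot `6₁`, is the
2-twist-spun trefoil (Litherland; Kanenobu; Gabai–Naylor–Schwartz, arXiv:2307.06388, §2.2).  If the band
meridian `m_A` of `A` bounded a disc in `B⁴ ∖ ρ(A)` missing the cap handle, then `[m_A] = 1` in the disc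
group `Γ_{ρA} ≅ Γ_A`, and van Kampen would force `Γ_A ≅ π₁(S⁴ ∖ S)`.  We certify that these two groups
are **not** isomorphic:

* `Γ_A = DiscGroup w₆₁ = ⟨x₁, x₂ | x₁ = w x₂ w⁻¹⟩`, `w₆₁ = x₂⁻¹ x₁` (the disc group of the ribbon disc
  `D(x₂⁻¹x₁)` of `6₁`; abstractly the Baumslag–Solitar group `BS(1,2)`);
* `TwistSpunTrefoilGroup = ⟨x, y | x y x = y x y, x² y = y x²⟩` (Zeeman: the group of the `k`-twist spin of `K`
  is `π_K` with `μ^k` made central; here `K = 3₁`, `k = 2`; abstractly `ℤ/3 ⋊ ℤ`).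

The invariant is the number of homomorphisms into the Frobenius group `F₂₀ = ℤ/5 ⋊ ℤ/4` (affine maps
`t ↦ 2^i t + b` of `ℤ/5`): `40` for `Γ_A`, `20` for the twist-spun trefoil group (brute force agrees:
`work/homcount/homcount.py`, which also checks `S₃, A₄, S₄, F₂₁, A₅, S₅`; the smallest separating group is
`F₂₀`).  The general facts used — homomorphisms out of a presented group are the generator assignments
killing the relators, and isomorphic groups have equinumerous `Hom(·, G)` — are proved here in full; the two
counts are kernel computations (`decide`).
-/

namespace Summit.SmoothPoincare4.SmoothPoincare4.Theorems
namespace FusionOne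

/-! ### Homomorphisms out of a presented group -/

section Presented

variable {α : Type*} (rels : Set (FreeGroup α)) (G : Type*) [Group G]

/-- Generator assignments `α → G` under which every relator evaluates to `1`. -/
def RelSolutions : Type _ := {f : α → G // ∀ r ∈ rels, FreeGroup.lift f r = 1}

variable {rels G}

/-- The lift of the generator images of `φ` is `φ ∘ mk`. -/
theorem lift_comp_of_eq (φ : PresentedGroup rels →* G) :
    FreeGroup.lift (fun a => φ (PresentedGroup.of a)) = φ.comp (PresentedGroup.mk rels) := by
  ext a
  simp only [FreeGroup.lift_apply_of, MonoidHom.coe_comp, Function.comp_apply]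
  rfl

variable (rels G) in
/-- `Hom(⟨α | rels⟩, G)` is in bijection with the relator-killing assignments `α → G`. -/
def homEquivRelSolutions : (PresentedGroup rels →* G) ≃ RelSolutions rels G where
  toFun φ := ⟨fun a => φ (PresentedGroup.of a), fun r hr => by
    rw [lift_comp_of_eq, MonoidHom.comp_apply, PresentedGroup.one_of_mem hr, map_one]⟩
  invFun v := PresentedGroup.toGroup v.2
  left_inv φ := by
    ext a
    simp
  right_inv v := by
    apply Subtype.ext
    funext a
    simp

/-- Precomposition with a group isomorphism is a bijection on `Hom(·, G)`. -/
def homCongrLeft {Γ₁ Γ₂ : Type*} [Group Γ₁] [Group Γ₂] (e : Γ₁ ≃* Γ₂) (G : Type*) [Group G] :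
    (Γ₁ →* G) ≃ (Γ₂ →* G) where
  toFun φ := φ.comp e.symm.toMonoidHom
  invFun ψ := ψ.comp e.toMonoidHom
  left_inv φ := by ext x; simp
  right_inv ψ := by ext x; simp

end Presented

/-! ### The two presented groups -/

/-- The band word `w₆₁ = x₂⁻¹ x₁` of the ribbon disc `D(x₂⁻¹x₁)` of the stevedore knot `6₁`. -/
def freeW61 : FreeGroup (Fin 2) := (FreeGroup.of 1)⁻¹ * FreeGroup.of 0

/-- The relator set of the `6₁` disc group: `{x₁⁻¹ · w x₂ w⁻¹}`. -/
abbrev rels61 : Set (FreeGroup (Fin 2)) := {discRelator freeW61}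

/-- First relator of the 2-twist-spun trefoil group: `x y x y⁻¹ x⁻¹ y⁻¹` (the braid relation). -/
def trefoilRelator : FreeGroup (Fin 2) :=
  FreeGroup.of 0 * FreeGroup.of 1 * FreeGroup.of 0 * (FreeGroup.of 1)⁻¹ * (FreeGroup.of 0)⁻¹ *
    (FreeGroup.of 1)⁻¹

/-- Second relator: `x² y x⁻² y⁻¹` (`μ²` is central). -/
def twistRelator : FreeGroup (Fin 2) :=
  FreeGroup.of 0 * FreeGroup.of 0 * FreeGroup.of 1 * (FreeGroup.of 0)⁻¹ * (FreeGroup.of 0)⁻¹ *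
    (FreeGroup.of 1)⁻¹

/-- The relator set of the 2-twist-spun trefoil group. -/
abbrev relsTwistSpunTrefoil : Set (FreeGroup (Fin 2)) := {trefoilRelator, twistRelator}

/-- The group of the 2-twist-spun trefoil, `⟨x, y | x y x = y x y, x² y = y x²⟩`. -/
abbrev TwistSpunTrefoilGroup : Type := PresentedGroup relsTwistSpunTrefoil

/-- Pairs `(a, b)` of elements of `G` satisfying the `6₁` disc relation `a = w b w⁻¹`, `w = b⁻¹ a`
(written as `a⁻¹ (w b w⁻¹) = 1`); for every group `G` this is a copy of `Hom(Γ_A(6₁), G)`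
(`homDiscGroup61Equiv`). -/
abbrev Sol61 (G : Type*) [Group G] : Type _ :=
  {p : G × G // p.1⁻¹ * (p.2⁻¹ * p.1 * p.2 * (p.2⁻¹ * p.1)⁻¹) = 1}

/-- Pairs `(a, b)` satisfying the two twist-spun-trefoil relations `a b a b⁻¹ a⁻¹ b⁻¹ = 1` and
`a a b a⁻¹ a⁻¹ b⁻¹ = 1`; a copy of `Hom(π(τ² 3₁), G)` (`homTwistSpunTrefoilEquiv`). -/
abbrev SolTST (G : Type*) [Group G] : Type _ :=
  {p : G × G // p.1 * p.2 * p.1 * p.2⁻¹ * p.1⁻¹ * p.2⁻¹ = 1 ∧ p.1 * p.1 * p.2 * p.1⁻¹ * p.1⁻¹ * p.2⁻¹ = 1}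

section Eval
variable {G : Type*} [Group G] (f : Fin 2 → G)

/-- Evaluation of the `6₁` disc relator under an assignment `f`. -/
theorem lift_discRelator_freeW61 :
    FreeGroup.lift f (discRelator freeW61) = (f 0)⁻¹ * ((f 1)⁻¹ * f 0 * f 1 * ((f 1)⁻¹ * f 0)⁻¹) := by
  simp only [discRelator, freeW61, map_mul, map_inv, FreeGroup.lift_apply_of]

/-- Evaluation of the braid relator under an assignment `f`. -/
theorem lift_trefoilRelator :
    FreeGroup.lift f trefoilRelator = f 0 * f 1 * f 0 * (f 1)⁻¹ * (f 0)⁻¹ * (f 1)⁻¹ := by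
  simp only [trefoilRelator, map_mul, map_inv, FreeGroup.lift_apply_of]

/-- Evaluation of the twist relator under an assignment `f`. -/
theorem lift_twistRelator :
    FreeGroup.lift f twistRelator = f 0 * f 0 * f 1 * (f 0)⁻¹ * (f 0)⁻¹ * (f 1)⁻¹ := by
  simp only [twistRelator, map_mul, map_inv, FreeGroup.lift_apply_of]

/-- An assignment kills the `6₁` relator set iff it satisfies the disc relation. -/
theorem relSolutions61_iff : (∀ r ∈ rels61, FreeGroup.lift f r = 1) ↔
    (f 0)⁻¹ * ((f 1)⁻¹ * f 0 * f 1 * ((f 1)⁻¹ * f 0)⁻¹) = 1 := by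
  simp only [Set.mem_singleton_iff, forall_eq, lift_discRelator_freeW61]

/-- An assignment kills the twist-spun-trefoil relator set iff it satisfies both relations. -/
theorem relSolutionsTST_iff :
    (∀ r ∈ relsTwistSpunTrefoil, FreeGroup.lift f r = 1) ↔
      f 0 * f 1 * f 0 * (f 1)⁻¹ * (f 0)⁻¹ * (f 1)⁻¹ = 1 ∧
        f 0 * f 0 * f 1 * (f 0)⁻¹ * (f 0)⁻¹ * (f 1)⁻¹ = 1 := by
  simp only [Set.mem_insert_iff, Set.mem_singleton_iff, forall_eq_or_imp, forall_eq,
    lift_trefoilRelator, lift_twistRelator]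

variable (G) in
/-- Relator-killing assignments for the `6₁` disc group are the pairs in `Sol61 G`. -/
def relSolutions61Equiv : RelSolutions rels61 G ≃ Sol61 G :=
  Equiv.subtypeEquiv (finTwoArrowEquiv G) fun f => by
    rw [relSolutions61_iff]; rfl

variable (G) in
/-- Relator-killing assignments for the twist-spun trefoil group are the pairs in `SolTST G`. -/
def relSolutionsTSTEquiv : RelSolutions relsTwistSpunTrefoil G ≃ SolTST G :=
  Equiv.subtypeEquiv (finTwoArrowEquiv G) fun f => by
    rw [relSolutionsTST_iff]; rfl

end Eval

/-! ### The Frobenius group `F₂₀ = ℤ/5 ⋊ ℤ/4` -/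

/-- `2^i (mod 5)` for `i : ℤ/4` (`2` has order `4` modulo `5`). -/
def pow2 : ZMod 4 → ZMod 5 := ![1, 2, 4, 3]

/-- `2^(i+j) = 2^i 2^j (mod 5)`. -/
theorem pow2_add (i j : ZMod 4) : pow2 (i + j) = pow2 i * pow2 j := by
  revert i j; decide

/-- `2^0 = 1`. -/
theorem pow2_zero : pow2 0 = 1 := by decide

/-- `2^(-i) 2^i = 1 (mod 5)`. -/
theorem pow2_neg_mul_self (i : ZMod 4) : pow2 (-i) * pow2 i = 1 := by
  revert i; decide

/-- The affine map `t ↦ 2^i t + b` of `ℤ/5`, recorded as `(b, i)`. -/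
@[ext]
structure F20 where
  /-- translation part -/
  b : ZMod 5
  /-- exponent of the multiplier `2^i` -/
  i : ZMod 4
  deriving DecidableEq

namespace F20

/-- `F20` is finite (it is in bijection with `ℤ/5 × ℤ/4`). -/
instance : Fintype F20 :=
  Fintype.ofEquiv (ZMod 5 × ZMod 4)
    { toFun := fun p => ⟨p.1, p.2⟩, invFun := fun x => (x.b, x.i),
      left_inv := fun _ => rfl, right_inv := fun _ => rfl }

/-- Composition of affine maps: `(t ↦ 2^i t + b) ∘ (t ↦ 2^j t + c) = (t ↦ 2^(i+j) t + (2^i c + b))`. -/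
instance : Group F20 where
  mul x y := ⟨x.b + pow2 x.i * y.b, x.i + y.i⟩
  one := ⟨0, 0⟩
  inv x := ⟨-(pow2 (-x.i) * x.b), -x.i⟩
  mul_assoc x y z := by
    apply F20.ext
    · show x.b + pow2 x.i * y.b + pow2 (x.i + y.i) * z.b = x.b + pow2 x.i * (y.b + pow2 y.i * z.b)
      rw [pow2_add]; ring
    · show x.i + y.i + z.i = x.i + (y.i + z.i)
      exact add_assoc _ _ _
  one_mul x := by
    apply F20.ext
    · show 0 + pow2 0 * x.b = x.b
      rw [pow2_zero]; ring
    · show 0 + x.i = x.i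
      exact zero_add _
  mul_one x := by
    apply F20.ext
    · show x.b + pow2 x.i * 0 = x.b
      ring
    · show x.i + 0 = x.i
      exact add_zero _
  inv_mul_cancel x := by
    apply F20.ext
    · show -(pow2 (-x.i) * x.b) + pow2 (-x.i) * x.b = 0
      ring
    · show -x.i + x.i = 0
      exact neg_add_cancel _

/-- `|F₂₀| = 20`. -/
theorem card : Fintype.card F20 = 20 := by
  rw [Fintype.ofEquiv_card]; rfl

end F20

/-! ### The counts -/

/-- `|Hom(Γ_A(6₁), F₂₀)| = 40`. -/
theorem card_sol61_F20 : Fintype.card (Sol61 F20) = 40 := by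
  decide

/-- `|Hom(π(τ² 3₁), F₂₀)| = 20`. -/
theorem card_solTST_F20 : Fintype.card (SolTST F20) = 20 := by
  decide

/-- `Hom(Γ_A(6₁), G) ≃ Sol61 G`. -/
def homDiscGroup61Equiv (G : Type*) [Group G] : (DiscGroup freeW61 →* G) ≃ Sol61 G :=
  (homEquivRelSolutions rels61 G).trans (relSolutions61Equiv G)

/-- `Hom(π(τ² 3₁), G) ≃ SolTST G`. -/
def homTwistSpunTrefoilEquiv (G : Type*) [Group G] : (TwistSpunTrefoilGroup →* G) ≃ SolTST G :=
  (homEquivRelSolutions relsTwistSpunTrefoil G).trans (relSolutionsTSTEquiv G)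

/-- **The `6₁` disc group is not isomorphic to the group of the 2-twist-spun trefoil.** -/
theorem discGroup61_not_iso_twistSpunTrefoilGroup :
    IsEmpty (DiscGroup freeW61 ≃* TwistSpunTrefoilGroup) := by
  refine ⟨fun e => ?_⟩
  have h := Fintype.card_congr <|
    (homDiscGroup61Equiv F20).symm.trans <| (homCongrLeft e F20).trans (homTwistSpunTrefoilEquiv F20)
  rw [card_sol61_F20, card_solTST_F20] at h
  omega

end FusionOne
end Summit.SmoothPoincare4.SmoothPoincare4.Theorems
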